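import Mathlib.LinearAlgebra.Matrix.Notation
import Mathlib.LinearAlgebra.Matrix.Determinant.Basic
import Literature.NumberTheory.EllipticCurves.OpenImage
import HarnessLib

/-!
# Serre's uniformity question — the SPLIT Cartan case is settled: `X_split(p)(ℚ)` is trivial
# for every prime `p ≥ 11` (Bilu–Parent–Rebolledo 2013, Cor. 1.2; Balakrishnan–Dogra–Müller–
# Tuitman–Vonk 2019, Thm. 1.2) — statement layer

Topic `Literature/NumberTheory/SerreUniformity`, companion of `Statement.lean` (which treats the
NON-split Cartan curves `X_ns⁺(p)`, the open side of Serre's question).  Statements only; the one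
deep result is vendored as a NAMED FACT (D-0014), not proved.  Filed by the BSD rank-≤1 residual
cell (unit `b2b-bsdres-x11c`, gen 7), which consumes it at a MULTIPLICATIVE prime: there an
irreducible non-surjective mod-`p` image lies in the normaliser of a split Cartan subgroup for
`p ≥ 7` (tree theorem
`Summit.BirchSwinnertonDyer.Rank1Residual.GaloisImage.exists_le_normalizer_splitCartan_of_mult_of_irr_of_not_surj`),
so the fact below forces surjectivity at multiplicative `p ≥ 11`.

Printed sources READ for this file:

* J. S. Balakrishnan, N. Dogra, J. S. Müller, J. Tuitman, J. Vonk, *Explicit Chabauty–Kim for the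
  split Cartan modular curve of level 13*, Ann. of Math. (2) 189 (2019), no. 3, 885–944
  (held: `paper:arxiv-1711.05846`), §1.1: **Theorem 1.1.** "The rational points on `X_s(13)`
  consist of six CM-points and one cusp."  **Theorem 1.2.** "Let `ℓ` be a prime number. Then
  there exists an elliptic curve `E/ℚ` without CM such that the image of its mod-`ℓ` Galois
  representation is contained in the normalizer of a split Cartan subgroup of `GL₂(𝔽_ℓ)` if and
  only if `ℓ ≤ 7`." ("Together with the results of Bilu–Parent and Bilu–Parent–Rebolledo, this
  allows us to complete the characterisation of all primes `ℓ` such that the mod-`ℓ` Galois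
  representation of a non-CM elliptic curve over `ℚ` is contained in the normalizer of a split
  Cartan subgroup of `GL₂(𝔽_ℓ)`.")
* Yu. Bilu, P. Parent, M. Rebolledo, *Rational points on `X₀⁺(pʳ)`*, Ann. Inst. Fourier 63
  (2013), no. 3, 957–984 (held: `paper:arxiv-1104.4641`), §1: **Theorem 1.1.** "The points of
  `X₀⁺(pʳ)(ℚ)` are trivial for all prime numbers `p ≥ 11`, `p ≠ 13`, and all integers `r > 1`."
  **Corollary 1.2.** "Let `E` be an elliptic curve over `ℚ` without complex multiplication and
  `p` a prime number, `p ≥ 11`, `p ≠ 13`. Then the image of the Galois representation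
  `ρ_{E,p} : Gal(ℚ̄/ℚ) → GL₂(𝔽_p)` is not contained in the normalizer of a split Cartan subgroup of
  `GL₂(𝔽_p)`."  (§1, before §2: "the normalizer of a split Cartan subgroup of `GL₂(𝔽_p)` (for
  instance, the subgroup of diagonal and anti-diagonal elements)"; "elliptic curves over `ℚ` for
  which the image of `ρ_{E,p}` is contained in the normalizer of a split Cartan subgroup are
  parametrized by the `ℚ`-points on the curve `X_spl(p) ≃ X₀⁺(p²)`".)

## Modelling (as in `Statement.lean`; the tree has no modular curves)

"The image of `ρ̄_{E,p}` is contained in the normaliser of a split Cartan subgroup of `GL₂(𝔽_p)`"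
is, all split Cartan subgroups being conjugate to the diagonal one, "in SOME `ℤ/p`-basis
`e : E[p] ≃ (ℤ/p)²` of the geometric `p`-torsion (`WeierstrassCurve.geomTorsion W p`, with its
`Γ_F`-action `σ • P`, file `EllipticCurves/GaloisAction`) every `σ ∈ Γ_F` acts through an
invertible DIAGONAL or ANTIDIAGONAL matrix" (BPR's "subgroup of diagonal and anti-diagonal
elements"): the predicate `HasSplitCartanNormalizerModPImage W p`, sibling of
`HasNonsplitCartanModPImage`.  "`E` without CM" is `¬ W.HasCM` (geometric CM, file
`EllipticCurves/Isogeny`).  The curve-free content of BDMTV Thm. 1.2 bearing on Galois images is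
its "only if" half: for a prime `p > 7` every `E/ℚ` with such an image HAS CM — the predicate
`SplitCartanPointsAreCM p` (= "every non-cuspidal `ℚ`-point of `X_split(p)` is CM"), asserted by
the named fact `BDMTV2019_splitCartanPointsAreCM` for all primes `p > 7`.  This is IMPLIED BY the
printed theorem and never stronger than it; the existence half ("if", `ℓ ≤ 7`) and the point
counts are not formalised (`-- TODO(general form): X_split(p) as a curve over ℚ; existence of
non-CM points for p ≤ 7`).

## Contents

* `splitCartanNormalizer p` — the invertible diagonal-or-antidiagonal `2 × 2` matrices over
  `ZMod p` (a set of matrices);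
* `HasSplitCartanNormalizerModPImage W p`, `SplitCartanPointsAreCM p` (predicates);
* named fact (NOT proved here): `BDMTV2019_splitCartanPointsAreCM`;
* proved from the fact: `hasCM_of_hasSplitCartanNormalizerModPImage` (the fact, applied),
  `not_hasSplitCartanNormalizerModPImage_of_not_hasCM` (contrapositive: BPR Cor. 1.2's wording,
  for all `p ≥ 11`).  Elementary API (the set is a proper subgroup, no unipotents, frames) lives
  with the consumer under `Summits/BirchSwinnertonDyer/Rank1Residual/GaloisImage/`.

## References

* [BalakrishnanEtAl2019] J. S. Balakrishnan, N. Dogra, J. S. Müller, J. Tuitman, J. Vonk, Ann. of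
  Math. 189 (2019), 885–944, §1.1 Thms. 1.1, 1.2.
* [BiluParentRebolledo2013] Yu. Bilu, P. Parent, M. Rebolledo, Ann. Inst. Fourier 63 (2013),
  957–984, Thm. 1.1, Cor. 1.2.
* [SerreInventiones1972] J.-P. Serre, Invent. Math. 15 (1972), §2.2 (Cartan subgroups and their
  normalisers).
-/

noncomputable section

open scoped Classical

universe u

namespace Literature.NumberTheory.SerreUniformity

open WeierstrassCurve Literature.NumberTheory.EllipticCurves

/-! ## The normaliser of the diagonal split Cartan subgroup of `GL₂(𝔽_p)` (explicit matrices) -/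

section Cartan

variable {p : ℕ}

/-- The **normaliser of the (diagonal) split Cartan subgroup** of `GL₂(𝔽_p)`, as a set of
matrices: the invertible matrices that are DIAGONAL, `(a 0; 0 d)`, or ANTIDIAGONAL, `(0 b; c 0)`
(Bilu–Parent–Rebolledo, §1: "the normalizer of a split Cartan subgroup of `GL₂(𝔽_p)` (for
instance, the subgroup of diagonal and anti-diagonal elements)"; Serre 1972, §2.2: for `p ≠ 2`
the elements of `N ∖ C` are those swapping the two lines `D₁`, `D₂`).  Every split Cartan
subgroup of `GL₂(𝔽_p)` is conjugate to the diagonal one, so "image contained in the normaliser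
of a split Cartan subgroup" is "image inside this set in a suitable basis".
[cite: BiluParentRebolledo2013, §1 (after Cor. 1.2)] -/
def splitCartanNormalizer (p : ℕ) : Set (Matrix (Fin 2) (Fin 2) (ZMod p)) :=
  {M | M.det ≠ 0 ∧ ((M 0 1 = 0 ∧ M 1 0 = 0) ∨ (M 0 0 = 0 ∧ M 1 1 = 0))}

end Cartan

/-! ## Mod-`p` image in the normaliser of a split Cartan subgroup -/

section Image

variable {F : Type u} [Field F]

/-- **The mod-`p` Galois image of `W` is contained in the normaliser of a split Cartan
subgroup**: there is a `ℤ/p`-basis `e : E[p](F̄) ≃ (ℤ/p)²` of the geometric `p`-torsion such that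
every `σ ∈ Γ_F` acts on `E[p]` through an invertible diagonal or antidiagonal matrix:
`e(σ • P) = M · e(P)`, `M ∈ splitCartanNormalizer p`.  Quantifying over the basis `e` absorbs "up
to conjugacy" (all split Cartan subgroups of `GL₂(𝔽_p)` are conjugate); for `F = ℚ` and `p` an
odd prime this says that `j(W)` is the `j`-invariant of a non-cuspidal `ℚ`-point of
`X_split(p) ≃ X₀⁺(p²)` (Bilu–Parent–Rebolledo §1).  A predicate (definition), not a fact.
[cite: BiluParentRebolledo2013, §1 (Cor. 1.2 and the paragraph before it)] -/
def HasSplitCartanNormalizerModPImage (W : WeierstrassCurve F) (p : ℕ) : Prop :=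
  ∃ e : W.geomTorsion p ≃+ (Fin 2 → ZMod p),
    ∀ σ : Field.absoluteGaloisGroup F, ∃ M ∈ splitCartanNormalizer p,
      ∀ P : W.geomTorsion p, e (σ • P) = M.mulVec (e P)

end Image

/-! ## "`X_split(p)(ℚ)` is trivial": the predicate and the named fact -/

/-- **Every `ℚ`-point of `X_split(p)` is CM or a cusp** (moduli form): every elliptic curve `E/ℚ`
whose mod-`p` Galois image is contained in the normaliser of a split Cartan subgroup of `GL₂(𝔽_p)`
has (geometric) complex multiplication.  A PREDICATE in `p`; a THEOREM for every prime `p ≥ 11`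
(Bilu–Parent–Rebolledo 2013 Cor. 1.2 for `p ≠ 13`, BDMTV 2019 Thm. 1.1 for `p = 13`; the named
fact below), FALSE for `p ≤ 7` (BDMTV 2019 Thm. 1.2, "if and only if `ℓ ≤ 7`"; not asserted here).
[cite: BiluParentRebolledo2013, Cor. 1.2] -/
def SplitCartanPointsAreCM (p : ℕ) : Prop :=
  ∀ (W : WeierstrassCurve ℚ) [W.IsElliptic], HasSplitCartanNormalizerModPImage W p → W.HasCM

/-- **Balakrishnan–Dogra–Müller–Tuitman–Vonk 2019, Theorem 1.2 ("only if" half) = Bilu–Parent–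
Rebolledo 2013, Corollary 1.2 (`p ≥ 11`, `p ≠ 13`) + BDMTV 2019, Theorem 1.1 (`p = 13`) — NAMED
FACT, not proved here.**  Printed (Ann. of Math. 189 (2019), §1.1, Thm. 1.2): "Let `ℓ` be a prime
number. Then there exists an elliptic curve `E/ℚ` without CM such that the image of its mod-`ℓ`
Galois representation is contained in the normalizer of a split Cartan subgroup of `GL₂(𝔽_ℓ)` if
and only if `ℓ ≤ 7`."  (Bilu–Parent–Rebolledo, Ann. Inst. Fourier 63 (2013), Cor. 1.2: "Let `E`
be an elliptic curve over `ℚ` without complex multiplication and `p` a prime number, `p ≥ 11`,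
`p ≠ 13`. Then the image of the Galois representation `ρ_{E,p}` … is not contained in the
normalizer of a split Cartan subgroup of `GL₂(𝔽_p)`"; the level `13` is BDMTV Thm. 1.1 by
quadratic Chabauty.)  Vendored content: for every prime `p > 7`, `SplitCartanPointsAreCM p` — the
contrapositive of the "only if" direction, IMPLIED BY the printed theorem; the "if" direction
(non-CM examples for `ℓ ≤ 7`) is not formalised. `-- TODO(general form): the existence half.`
[cite: BalakrishnanEtAl2019, §1.1 Thm. 1.2] [cite: BiluParentRebolledo2013, Cor. 1.2] -/
def BDMTV2019_splitCartanPointsAreCM : Prop :=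
  ∀ p : ℕ, p.Prime → 7 < p → SplitCartanPointsAreCM p

/-- The fact applied: for a prime `p > 7`, an elliptic curve over `ℚ` with mod-`p` image in the
normaliser of a split Cartan subgroup has CM. Real proof from the fact as hypothesis.
[cite: BalakrishnanEtAl2019, §1.1 Thm. 1.2] -/
theorem hasCM_of_hasSplitCartanNormalizerModPImage (h : BDMTV2019_splitCartanPointsAreCM)
    {p : ℕ} (hp : p.Prime) (h7 : 7 < p) (W : WeierstrassCurve ℚ) [W.IsElliptic]
    (himg : HasSplitCartanNormalizerModPImage W p) : W.HasCM :=
  h p hp h7 W himg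

/-- **Bilu–Parent–Rebolledo 2013, Cor. 1.2, in its printed wording and for every prime `p ≥ 11`
(level `13` included by BDMTV 2019):** a non-CM elliptic curve over `ℚ` has mod-`p` image NOT
contained in the normaliser of a split Cartan subgroup. Real proof from the fact as hypothesis.
[cite: BiluParentRebolledo2013, Cor. 1.2] [cite: BalakrishnanEtAl2019, §1.1 Thm. 1.2] -/
theorem not_hasSplitCartanNormalizerModPImage_of_not_hasCM (h : BDMTV2019_splitCartanPointsAreCM)
    {p : ℕ} (hp : p.Prime) (h11 : 11 ≤ p) (W : WeierstrassCurve ℚ) [W.IsElliptic]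
    (hW : ¬ W.HasCM) : ¬ HasSplitCartanNormalizerModPImage W p :=
  fun himg => hW (h p hp (by omega) W himg)

end Literature.NumberTheory.SerreUniformity

end
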